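import Literature.AlgebraicGeometry.Motives.AbelianVarietyBlochFiltrationSkeleton
import Literature.AlgebraicGeometry.Motives.AbelianVarietyLie
import Literature.AlgebraicGeometry.Motives.JacobianHomology
import Literature.AlgebraicGeometry.Motives.CyclesPushforwardProofs
import Literature.AlgebraicGeometry.Motives.CyclesBirationalLiftProofs
import Literature.AlgebraicGeometry.Resolution.AlterationsNodalFibre
import HarnessLib

/-!
# The Bloch filtration: transfer along surjective homomorphisms and divisibility
# (the elementary geometric inputs of Voisin II, Lemmas 11.30–11.31)

This file feeds the formal skeleton of Bloch's theorem
(`Motives/AbelianVarietyBlochFiltrationSkeleton`) with the two geometric inputs of Voisin's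
proof of Thm. 11.29 that the tree CAN supply, for complex abelian varieties:

* **`φ_* {P} = {φ P}` and transfer.** For a homomorphism `φ : B → A` of complex abelian
  varieties, `AbelianVariety.pointsMap φ : B(ℂ) →* A(ℂ)` is the induced group homomorphism on
  complex points, SURJECTIVE when `φ` is surjective (`pointsMap_surjective`: closed points of the
  Jacobson scheme `B` in the fibres, the tree's `AlgPoints.map_surjective_of_surjective`), and
  proper push-forward on `CH₀` (the tree's `ChowGroup.pushforward` with Fulton's Thm. 1.4
  `map_mem_ratTrivial_holds`) sends the class of a complex point to the class of its image
  (`pushforward_pointClass`: `κ(φ P) = κ(P) = ℂ`, `algebraicCycleMap_primeCycle_of_…`). Hence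
  Voisin II, Lemma 11.31, first paragraph: `φ_* F^n CH₀(B) = F^n CH₀(A)` for surjective `φ`
  (`blochFiltration_map_pushforward`), so `F^n CH₀(B) = 0 ⇒ F^n CH₀(A) = 0`
  (`blochFiltration_eq_bot_of_hom_surjective`).
* **`A(ℂ)` is divisible** (`exists_pow_eq`: `[N]_A` is an isogeny, in particular surjective,
  for `N ≠ 0` — Milne, *Abelian Varieties*, Thm. 8.2; Görtz–Wedhorn II Prop. 27.187, the tree's
  PROVED `surjective_zsmul_id` with `cotangentMap_zsmul_id_holds`), whence the formal half of
  Lemma 11.30 with only its genuinely cohomological hypothesis left: if `N ≠ 0` kills the expanded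
  Pontryagin products with `l ≥ 1` factors modulo `F^{l+1} CH₀(A)`, then
  `F^l CH₀(A) = F^{l+1} CH₀(A)` (`blochFiltration_le_succ_of_smul_mem'`).

The assembly `Bloch1976_pontryaginPower_eq_zero_of_factorial_smul_mem_of_eventually_eq_bot`
records what is then left of Bloch's theorem (the named fact
`Bloch1976_pontryaginPower_eq_zero`): (i) for `l > dim A`, `l!` kills the `l`-fold expanded
products modulo `F^{l+1}` (Voisin II, Lemma 11.30: hard Lefschetz through a complete-intersection
curve, `l! z = J_* J^*(D₁ ⋯ D_l) = 0`), and (ii) `F^N CH₀(A) = 0` for some `N` (Lemma 11.31: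
`A` is a quotient of a Jacobian `J(C)`, and `F^{g(C)+1} CH₀(J(C)) = 0` by Lemmas 11.32–11.33).
Everything here is proved; no named fact is introduced.

## References

* [VoisinHodgeII2003] C. Voisin, Hodge Theory and Complex Algebraic Geometry II, CUP 2003,
  §11.3.2 pp. 330–331: Lemmas 11.30, 11.31 (proofs).
* [Milne1986AbelianVarieties] J. S. Milne, Abelian Varieties, Ch. V of Cornell–Silverman,
  Arithmetic Geometry (1986), Thm. 8.2 (`n_A` is an isogeny of degree `n^{2g}`).
* [Fulton1998] W. Fulton, Intersection Theory, §1.4 (proper push-forward of a point).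
-/

noncomputable section

open CategoryTheory AlgebraicGeometry Order
open scoped MonObj

universe u

namespace Literature.AlgebraicGeometry.Motives

namespace AbelianVariety

/-! ### The homomorphism on points induced by a homomorphism of abelian varieties -/

section PointsMap

variable {k : Type u} [Field k] {A B : AbelianVariety k} (L : Type u) [Field L] [Algebra k L]

/-- The group homomorphism `φ(L) : B(L) → A(L)`, `P ↦ φ ∘ P`, induced on `L`-valued points by a
homomorphism `φ : B → A` of abelian varieties (a homomorphism of group schemes acts by group
homomorphisms on points: Mathlib `MonObj.one_comp`, `MonObj.mul_comp`; Mumford, *Abelian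
Varieties*, §4). [folklore] -/
def pointsMap (φ : B ⟶ A) : B.Points L →* A.Points L where
  toFun := AlgPoints.map φ.hom.hom.hom
  map_one' := MonObj.one_comp φ.hom.hom.hom
  map_mul' P Q := MonObj.mul_comp P Q φ.hom.hom.hom

/-- `pointsMap φ P` is the point `φ ∘ P`. [folklore] -/
@[simp]
theorem pointsMap_apply (φ : B ⟶ A) (P : B.Points L) :
    pointsMap L φ P = AlgPoints.map φ.hom.hom.hom P :=
  rfl

end PointsMap

section Complex

variable {A B : AbelianVariety ℂ}

/-- **A surjective homomorphism of complex abelian varieties is surjective on complex points**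
(closed points = complex points on a finite-type `ℂ`-scheme; the tree's
`AlgPoints.map_surjective_of_surjective`). In Voisin II, Lemma 11.31: "if `φ` is surjective, …
`φ_* : CH₀(B)_hom → CH₀(A)_hom` is surjective". [folklore] -/
theorem pointsMap_surjective (φ : B ⟶ A) (hφ : Surjective (Hom.toSchemeHom φ)) :
    Function.Surjective (pointsMap ℂ φ) := by
  haveI : Surjective φ.hom.hom.hom.left := hφ
  exact AlgPoints.map_surjective_of_surjective φ.hom.hom.hom

/-- Multiplication by `N` acts on complex points as `P ↦ P ^ N` (group law written
multiplicatively): the additive structure of `End(A)` is the pointwise one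
(`AbelianVariety.hom_add`) and evaluation at a point is a monoid homomorphism
(`MonObj.comp_pow`). [folklore] -/
theorem pointsMap_nsmul_id (A : AbelianVariety ℂ) (N : ℕ) (P : A.Points ℂ) :
    pointsMap ℂ (N • 𝟙 A) P = P ^ N := by
  have hnsmul : ∀ (n : ℕ) (g : A ⟶ A), (n • g).hom = g.hom ^ n := fun _ _ => rfl
  rw [pointsMap_apply, AlgPoints.map_apply, hnsmul, Grp.Hom.hom_pow, Mon.Hom.hom_pow,
    MonObj.comp_pow, AbelianVariety.id_hom]
  rfl

/-- **`A(ℂ)` is a divisible group**: for `N ≠ 0` every complex point is an `N`-th power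
(`[N]_A : A → A` is an isogeny, in particular surjective — Milne, *Abelian Varieties*, Thm. 8.2:
"`n_A : A → A` is an isogeny of degree `n^{2g}`"; the tree's PROVED `surjective_zsmul_id` with
`cotangentMap_zsmul_id_holds` — and surjective morphisms are surjective on complex points,
`pointsMap_surjective`). This is the divisibility used in Voisin II, Lemma 11.30 ("as it is
clearly a divisible group, it must be trivial"). [cite: Milne1986AbelianVarieties, Thm. 8.2] -/
theorem exists_pow_eq (A : AbelianVariety ℂ) {N : ℕ} (hN : N ≠ 0) (P : A.Points ℂ) :
    ∃ Q : A.Points ℂ, Q ^ N = P := by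
  have hsurj : Surjective (Hom.toSchemeHom ((N : ℤ) • 𝟙 A)) :=
    surjective_zsmul_id (cotangentMap_zsmul_id_holds (A := A)) N (by exact_mod_cast hN)
  rw [natCast_zsmul] at hsurj
  obtain ⟨Q, hQ⟩ := pointsMap_surjective (N • 𝟙 A) hsurj P
  exact ⟨Q, by rw [← pointsMap_nsmul_id, hQ]⟩

/-! ### Proper push-forward of a point class -/

attribute [local instance] isProper_toSchemeHom

/-- **`φ_* {P} = {φ(P)}`** for a homomorphism `φ : B → A` of complex abelian varieties and a
complex point `P ∈ B(ℂ)`: the proper push-forward (Fulton §1.4; the tree's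
`ChowGroup.pushforward` with `map_mem_ratTrivial_holds`) of the class of the closed point under
`P` is the class of the closed point under `φ ∘ P`, with coefficient `[κ(P) : κ(φ P)] = 1` since
both residue fields are `ℂ` (`Resolution.residueFieldMap_surjective_of_isClosed`,
`algebraicCycleMap_primeCycle_of_residueFieldMap_surjective`). [cite: Fulton1998, §1.4] -/
theorem pushforward_pointClass (φ : B ⟶ A) (P : B.Points ℂ) :
    ChowGroup.pushforward 0 (map_mem_ratTrivial_holds 0) φ.hom.hom.hom (B.pointClass P) =
      A.pointClass (pointsMap ℂ φ P) := by
  rw [pointClass, pointClass, ChowGroup.ofPoint, ChowGroup.ofPoint, ChowGroup.pushforward_mk]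
  congr 1
  apply Subtype.ext
  rw [coe_cyclesOfDimMap]
  haveI : LocallyOfFiniteType (φ.hom.hom.hom.left ≫ A.X.hom) := by
    rw [Over.w φ.hom.hom.hom]; infer_instance
  have h1 : IsClosed ({P.pt} : Set B.X.left) := ComplexPoints.isClosed_pt P
  have h2 : IsClosed ({φ.hom.hom.hom.left P.pt} : Set A.X.left) :=
    ComplexPoints.isClosed_pt (AlgPoints.map φ.hom.hom.hom P)
  exact algebraicCycleMap_primeCycle_of_residueFieldMap_surjective φ.hom.hom.hom.left A.X.hom
    P.pt (Resolution.residueFieldMap_surjective_of_isClosed φ.hom.hom.hom.left A.X.hom h1 h2)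

/-! ### Consequences for the Bloch filtration -/

/-- **Voisin II, Lemma 11.31, first paragraph: `φ_* F^n CH₀(B) = F^n CH₀(A)`** for a SURJECTIVE
homomorphism `φ : B → A` of complex abelian varieties ("`φ_*` is a morphism of rings for the
Pontryagin product … if `φ` is surjective, we actually have `φ_* F^i CH₀(B) = F^i CH₀(A)`").
[cite: VoisinHodgeII2003, Lemma 11.31 (proof, first paragraph)] -/
theorem blochFiltration_map_pushforward (φ : B ⟶ A) (hφ : Surjective (Hom.toSchemeHom φ))
    (n : ℕ) :
    (B.blochFiltration n).map (ChowGroup.pushforward 0 (map_mem_ratTrivial_holds 0) φ.hom.hom.hom) =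
      A.blochFiltration n :=
  map_blochFiltrationOf_eq B.pointClass A.pointClass (pointsMap ℂ φ) _
    (fun P => pushforward_pointClass φ P) (pointsMap_surjective φ hφ) n

/-- **"Thus, if the result holds for `B`, it also holds for `A`"** (Voisin II, Lemma 11.31): along
a surjective homomorphism `φ : B → A` of complex abelian varieties, `F^n CH₀(B) = 0` implies
`F^n CH₀(A) = 0`. [cite: VoisinHodgeII2003, Lemma 11.31 (proof, first paragraph)] -/
theorem blochFiltration_eq_bot_of_hom_surjective (φ : B ⟶ A)
    (hφ : Surjective (Hom.toSchemeHom φ)) {n : ℕ} (h : B.blochFiltration n = ⊥) :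
    A.blochFiltration n = ⊥ := by
  rw [← blochFiltration_map_pushforward φ hφ n, h, AddSubgroup.map_bot]

/-- **Voisin II, Lemma 11.30, with divisibility discharged.** If some `N ≠ 0` annihilates the
expanded Pontryagin products with exactly `l ≥ 1` factors modulo `F^{l+1} CH₀(A)` (Voisin:
`N = l!` for `l > dim A`, `l! z = J_* J^*(D₁ ⋯ D_l) = 0` by hard Lefschetz through a curve), then
`F^l CH₀(A) = F^{l+1} CH₀(A)`: `A(ℂ)` is divisible (`exists_pow_eq`) and the graded piece is a
quotient of `A(ℂ)^{⊗l}` (`blochFiltration_le_succ_of_smul_mem`).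
[cite: VoisinHodgeII2003, Lemma 11.30] -/
theorem blochFiltration_le_succ_of_smul_mem' (A : AbelianVariety ℂ) {l : ℕ} (hl : l ≠ 0) {N : ℕ}
    (hN : N ≠ 0)
    (hkill : ∀ (u : A.Points ℂ) (Q : ℕ → A.Points ℂ) (s : Finset ℕ), s.card = l →
      (N : ℤ) • blochGen A.pointClass u Q s ∈ A.blochFiltration (l + 1)) :
    A.blochFiltration l ≤ A.blochFiltration (l + 1) :=
  A.blochFiltration_le_succ_of_smul_mem hl (fun P => A.exists_pow_eq hN P) hkill

end Complex

end AbelianVariety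

/-- **What is left of Bloch's theorem after the algebra and the elementary geometry** (Voisin II,
proof of Thm. 11.29): the named fact `Bloch1976_pontryaginPower_eq_zero` follows from
(i) the cohomological core of Lemma 11.30 — for `l > dim A`, `l!` kills the `l`-fold expanded
Pontryagin products `{u} ⋆ ∏_{i<l} ({Qᵢ} - {0})` modulo `F^{l+1} CH₀(A)` — and (ii) Lemma 11.31 —
`F^N CH₀(A) = 0` for some `N` (a quotient of a Jacobian, `blochFiltration_eq_bot_of_hom_surjective`,
and the Jacobian case, Lemmas 11.32–11.33). Neither (i) nor (ii) is proved in the tree.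
[cite: VoisinHodgeII2003, Thm. 11.29 (proof)] -/
theorem Bloch1976_pontryaginPower_eq_zero_of_factorial_smul_mem_of_eventually_eq_bot
    (h30 : ∀ (A : AbelianVariety ℂ) (l : ℕ), A.dim < l →
      ∀ (u : A.Points ℂ) (Q : ℕ → A.Points ℂ) (s : Finset ℕ), s.card = l →
        (l.factorial : ℤ) • blochGen A.pointClass u Q s ∈ A.blochFiltration (l + 1))
    (h31 : ∀ A : AbelianVariety ℂ, ∃ N, A.blochFiltration N = ⊥) :
    Bloch1976_pontryaginPower_eq_zero :=
  Bloch1976_pontryaginPower_eq_zero_of_voisin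
    (fun A l hl => A.blochFiltration_le_succ_of_smul_mem' (by omega) (Nat.factorial_ne_zero l)
      (h30 A l hl))
    h31

end Literature.AlgebraicGeometry.Motives

end
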